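import Literature.Barriers.CriticalPhenomena.LaceExpansionIsingDeconvolutionProp12
import Mathlib.MeasureTheory.Integral.IntervalIntegral.IntegrationByParts
import Mathlib.MeasureTheory.Integral.Prod
import Mathlib.MeasureTheory.Function.LocallyIntegrable
import Mathlib.Order.Fin.Tuple
import HarnessLib

/-!
# Liu–Slade 2026, Lemma 3.1 (one axis, classical form): the proof
# (`LiuSlade2026_lem31_fiber_holds`)

Barrier catalogue `Literature/Barriers/CriticalPhenomena/` (D-0021); discharges the named fact
`SpreadOutIsing.LiuSlade2026_lem31_fiber` of `LaceExpansionIsingDeconvolutionProp12.lean` — Liu–Slade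
2026, Lemma 3.1 (= Liu–Slade 2024, Lemma 2.3 in the arXiv numbering: "smoothness of a function
on `𝕋^d` is related to the decay of its Fourier coefficient";
`|h(x)| ≤ c_{d,a}⟦x⟧^{-a} max_{|α|∈{0,a}} ‖ĥ_α‖_1`, whose proof there is a reference to Grafakos'
*Classical Fourier Analysis* — "the proof … only uses integration by parts") in the classical
one-axis form consumed by the proof of Proposition 1.2:
`|x_j|^a |∫_{[-π,π]^d} g_0(k) cos(k·x) dk| ≤ ∫_{[-π,π]^d} |g_a(k)| dk` for a family `g_0, …, g_a`
of fibrewise `k_j`-derivatives, `2π`-periodic in `k_j`, off the null `j`-axis.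

The proof is the integration-by-parts argument referred to there, written classically:
* `intervalIntegral_mul_cos_eq_of_periodic` — one integration by parts on `[-π,π]` against
  `cos(t n + c)`, `n ∈ ℤ ∖ {0}`: the boundary terms cancel by periodicity;
* `abs_pow_mul_intervalIntegral_cos_le` — `a` such steps: `|n|^a |∫ u_0 cos(tn + c)| ≤ ∫ |u_a|`;
* `LiuSlade2026_lem31_fiber_holds` — Fubini over the fibres `{k_j := t}` of the cube
  (`MeasurableEquiv.piFinSuccAbove`), the one-variable bound on almost every fibre, Fubini back.

## References

* Y. Liu, G. Slade, *Gaussian deconvolution and the lace expansion for spread-out models*,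
  Ann. Inst. H. Poincaré Probab. Statist. 62 (2026), arXiv:2310.07640: Lemma 3.1 with (3.7)
  [LiuSlade2026].
* Y. Liu, G. Slade, *Gaussian deconvolution and the lace expansion*, Probab. Theory Related
  Fields 195 (2024), arXiv:2310.07635: Lemma 2.3 (arXiv numbering) and its proof ("follows from
  [Grafakos] … only uses integration by parts") [LiuSlade2024]. (The decomposition file cites this
  lemma as "Lemma 2.2 and Appendix A"; the correct locator is Lemma 2.3, and Appendix A of that
  paper is about weak derivatives, not this proof.)
-/

noncomputable section

namespace Literature.Barriers.CriticalPhenomena.SpreadOutIsing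

open Filter Finset Literature.Probability.LatticeModels Real intervalIntegral
open _root_.MeasureTheory _root_.Topology

/-! ### One integration by parts on the period interval -/

/-- **One periodic integration by parts**: for `n ∈ ℤ ∖ {0}`, `u` differentiable on `[-π,π]` with
`u(-π) = u(π)` and integrable derivative `u'`,
`∫_{-π}^{π} u(t) cos(tn + c) dt = -(1/n) ∫_{-π}^{π} u'(t) sin(tn + c) dt` (the boundary term
`[u sin(tn+c)/n]_{-π}^{π}` vanishes because both factors are `2π`-periodic). [cite: LiuSlade2024, Lemma 2.3 (arXiv numbering), proof ("only uses integration by parts")] -/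
theorem intervalIntegral_mul_cos_eq_of_periodic {u u' : ℝ → ℝ} {n : ℤ} (hn : n ≠ 0) (c : ℝ)
    (hu : ∀ t ∈ Set.uIcc (-π) π, HasDerivAt u (u' t) t) (hper : u (-π) = u π)
    (hu' : IntervalIntegrable u' volume (-π) π) :
    ∫ t in (-π)..π, u t * Real.cos (t * n + c) =
      -((n : ℝ)⁻¹ * ∫ t in (-π)..π, u' t * Real.sin (t * n + c)) := by
  have hn' : (n : ℝ) ≠ 0 := by exact_mod_cast hn
  -- `v = sin(tn + c)/n`, `v' = cos(tn + c)`
  set v : ℝ → ℝ := fun t => Real.sin (t * n + c) / n with hv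
  have hvd : ∀ t ∈ Set.uIcc (-π) π, HasDerivAt v (Real.cos (t * n + c)) t := by
    intro t _
    have h1 : HasDerivAt (fun t : ℝ => t * n + c) (n : ℝ) t := by
      simpa using ((hasDerivAt_id t).mul_const (n : ℝ)).add_const c
    have h2 := (Real.hasDerivAt_sin (t * n + c)).comp t h1
    have h3 := h2.div_const (n : ℝ)
    rw [mul_div_assoc, div_self hn', mul_one] at h3
    exact h3
  have hv' : IntervalIntegrable (fun t => Real.cos (t * n + c)) volume (-π) π :=
    (by fun_prop : Continuous fun t : ℝ => Real.cos (t * n + c)).intervalIntegrable _ _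
  have hibp := integral_mul_deriv_eq_deriv_mul hu hvd hu' hv'
  -- the boundary term vanishes
  have hvπ : v π = v (-π) := by
    simp only [hv]
    rw [show -π * n + c = π * n + c - n * (2 * π) by ring, Real.sin_sub_int_mul_two_pi]
  rw [hibp, hper, hvπ, sub_self, zero_sub, hv, neg_inj, ← intervalIntegral.integral_const_mul]
  refine intervalIntegral.integral_congr fun t _ => ?_
  simp only
  field_simp

/-- **Iterated periodic integration by parts** (the proof of Liu–Slade 2024, Lemma 2.3): if `u_0, …, u_a` satisfy
`u_m' = u_{m+1}` on `[-π,π]` and `u_m(-π) = u_m(π)` for `m < a`, with `u_0, u_a` integrable, then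
for every `n ∈ ℤ` and phase `c`, `|n|^a |∫_{-π}^{π} u_0(t) cos(tn + c) dt| ≤ ∫_{-π}^{π} |u_a(t)| dt`.
[cite: LiuSlade2024, Lemma 2.3 (arXiv numbering), proof] -/
theorem abs_pow_mul_intervalIntegral_cos_le (a : ℕ) :
    ∀ (u : ℕ → ℝ → ℝ) (n : ℤ) (c : ℝ),
      (∀ m < a, ∀ t ∈ Set.uIcc (-π) π, HasDerivAt (u m) (u (m + 1) t) t) →
      (∀ m < a, u m (-π) = u m π) →
      IntervalIntegrable (u 0) volume (-π) π → IntervalIntegrable (u a) volume (-π) π →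
      |(n : ℝ)| ^ a * |∫ t in (-π)..π, u 0 t * Real.cos (t * n + c)| ≤
        ∫ t in (-π)..π, |u a t| := by
  have hππ : -π ≤ π := by linarith [Real.pi_pos]
  induction a with
  | zero =>
    intro u n c _ _ h0 _
    rw [pow_zero, one_mul]
    calc |∫ t in (-π)..π, u 0 t * Real.cos (t * n + c)|
        ≤ ∫ t in (-π)..π, |u 0 t * Real.cos (t * n + c)| := abs_integral_le_integral_abs hππ
      _ ≤ ∫ t in (-π)..π, |u 0 t| := by
          refine intervalIntegral.integral_mono_on hππ ?_ h0.abs fun t _ => ?_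
          · exact (h0.mul_continuousOn (by fun_prop)).abs
          · rw [abs_mul]
            exact mul_le_of_le_one_right (abs_nonneg _) (Real.abs_cos_le_one _)
  | succ a ih =>
    intro u n c hder hper h0 ha
    by_cases hn : n = 0
    · subst hn
      rw [Int.cast_zero, abs_zero, zero_pow (Nat.succ_ne_zero a), zero_mul]
      exact intervalIntegral.integral_nonneg hππ fun t _ => abs_nonneg _
    -- `u 1` is interval integrable
    have h1 : IntervalIntegrable (u 1) volume (-π) π := by
      rcases Nat.eq_zero_or_pos a with ha0 | ha0
      · subst ha0; exact ha
      · refine ContinuousOn.intervalIntegrable fun t ht => ?_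
        exact (hder 1 (by omega) t ht).continuousAt.continuousWithinAt
    -- one integration by parts, then the induction hypothesis for the shifted family
    rw [intervalIntegral_mul_cos_eq_of_periodic hn c (hder 0 (Nat.zero_lt_succ a))
      (hper 0 (Nat.zero_lt_succ a)) h1]
    have hsin : ∫ t in (-π)..π, u 1 t * Real.sin (t * n + c) =
        ∫ t in (-π)..π, u 1 t * Real.cos (t * n + (c - π / 2)) := by
      refine intervalIntegral.integral_congr fun t _ => ?_
      rw [show t * n + (c - π / 2) = t * n + c - π / 2 by ring, Real.cos_sub_pi_div_two]
    have hih := ih (fun m => u (m + 1)) n (c - π / 2) (fun m hm => hder (m + 1) (by omega))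
      (fun m hm => hper (m + 1) (by omega)) h1 ha
    have hn' : (n : ℝ) ≠ 0 := by exact_mod_cast hn
    have hnabs : 0 < |(n : ℝ)| := abs_pos.2 hn'
    calc |(n : ℝ)| ^ (a + 1) * |-((n : ℝ)⁻¹ * ∫ t in (-π)..π, u 1 t * Real.sin (t * n + c))|
        = |(n : ℝ)| ^ a * |∫ t in (-π)..π, u 1 t * Real.cos (t * n + (c - π / 2))| := by
          rw [abs_neg, abs_mul, abs_inv, hsin, pow_succ, mul_assoc, ← mul_assoc |(n : ℝ)|,
            mul_inv_cancel₀ hnabs.ne', one_mul]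
      _ ≤ ∫ t in (-π)..π, |u (a + 1) t| := hih

/-! ### Fibres of the cube along one axis -/

section Fibres

variable {n : ℕ}

/-- `k ∈ [-π,π]^{n+1}` iff `k_j ∈ [-π,π]` and `k' ∈ [-π,π]^n`, for `k = (t ↦ j, k')`. [folklore] -/
theorem insertNth_mem_cube_iff (j : Fin (n + 1)) (t : ℝ) (k' : Fin n → ℝ) :
    (j.insertNth t k' : Fin (n + 1) → ℝ) ∈ cube (n + 1) ↔ t ∈ Set.Icc (-π) π ∧ k' ∈ cube n := by
  simp only [cube, Set.mem_pi, Set.mem_univ, true_imp_iff]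
  rw [Fin.forall_iff_succAbove j, Fin.insertNth_apply_same]
  simp only [Fin.insertNth_apply_succAbove]

/-- `k·x = t x_j + Σ_{i ≠ j} k_i x_i` on the fibre `k = (t ↦ j, k')`. [folklore] -/
theorem kdot_insertNth (j : Fin (n + 1)) (t : ℝ) (k' : Fin n → ℝ) (x : Site (n + 1)) :
    kdot (j.insertNth t k' : Fin (n + 1) → ℝ) x =
      t * (x j : ℝ) + ∑ l, k' l * (x (j.succAbove l) : ℝ) := by
  unfold kdot
  rw [Fin.sum_univ_succAbove _ j, Fin.insertNth_apply_same]
  simp only [Fin.insertNth_apply_succAbove]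

/-- `(0 ↦ j, k') = 0` forces `k' = 0`. [folklore] -/
theorem eq_zero_of_insertNth_zero (j : Fin (n + 1)) {k' : Fin n → ℝ}
    (h : (j.insertNth 0 k' : Fin (n + 1) → ℝ) = 0) : k' = 0 := by
  funext l
  have := congrFun h (j.succAbove l)
  simpa using this

end Fibres

/-! ### The theorem -/

/-- **Discharge of `LiuSlade2026_lem31_fiber`** — Liu–Slade 2026, Lemma 3.1 (one axis, classical
form): Fubini over the fibres `{k_j := t}` of `[-π,π]^d` and `a` periodic integrations by parts on
almost every fibre. [cite: LiuSlade2026, Lemma 3.1 with (3.7)] [cite: LiuSlade2024, Lemma 2.3 (arXiv numbering)] -/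
theorem LiuSlade2026_lem31_fiber_holds : LiuSlade2026_lem31_fiber := by
  intro d hd j a g hg0 hga hder hper x
  obtain ⟨n, rfl⟩ : ∃ n, d = n + 1 := ⟨d - 1, by omega⟩
  have hππ : -π ≤ π := by linarith [Real.pi_pos]
  haveI : Nonempty (Fin n) := ⟨⟨0, by omega⟩⟩
  -- the fibre decomposition of the cube
  set e : ℝ × (Fin n → ℝ) ≃ᵐ (Fin (n + 1) → ℝ) :=
    (MeasurableEquiv.piFinSuccAbove (fun _ => ℝ) j).symm with he
  have he_apply : ∀ p : ℝ × (Fin n → ℝ), e p = j.insertNth p.1 p.2 := fun p => rfl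
  have hem : MeasurePreserving e (volume : Measure (ℝ × (Fin n → ℝ))) volume :=
    (volume_preserving_piFinSuccAbove (fun _ : Fin (n + 1) => ℝ) j).symm _
  have hpre : e ⁻¹' cube (n + 1) = Set.Icc (-π) π ×ˢ cube n := by
    rw [cube, cube, Set.pi_univ_Icc, Set.pi_univ_Icc]
    exact ((Fin.insertNthOrderIso (fun _ => ℝ) j).preimage_Icc _ _).trans (Set.Icc_prod_eq _ _)
  set μ₁ : Measure ℝ := volume.restrict (Set.Icc (-π) π) with hμ₁
  set μ₂ : Measure (Fin n → ℝ) := volume.restrict (cube n) with hμ₂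
  -- transport of integrability and of integrals to the product `[-π,π] × [-π,π]^n`
  have hintT : ∀ {G : (Fin (n + 1) → ℝ) → ℝ}, IntegrableOn G (cube (n + 1)) volume →
      Integrable (fun p : ℝ × (Fin n → ℝ) => G (j.insertNth p.1 p.2)) (μ₁.prod μ₂) := by
    intro G hG
    have h := (hem.integrableOn_comp_preimage e.measurableEmbedding).2 hG
    rw [hpre, IntegrableOn, Measure.volume_eq_prod, ← Measure.prod_restrict] at h
    exact h
  have htrans : ∀ {G : (Fin (n + 1) → ℝ) → ℝ}, IntegrableOn G (cube (n + 1)) volume →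
      ∫ k in cube (n + 1), G k = ∫ k' in cube n, ∫ t in Set.Icc (-π) π, G (j.insertNth t k') := by
    intro G hG
    rw [← hem.setIntegral_preimage_emb e.measurableEmbedding G (cube (n + 1)), hpre,
      Measure.volume_eq_prod, ← Measure.prod_restrict]
    show ∫ p, G (j.insertNth p.1 p.2) ∂(μ₁.prod μ₂) = _
    rw [integral_prod_symm _ (hintT hG)]
  -- the two integrals as iterated integrals
  have hcont : Continuous fun k : Fin (n + 1) → ℝ => Real.cos (kdot k x) :=
    Real.continuous_cos.comp (continuous_kdot_left x)
  have hG0 : IntegrableOn (fun k => g 0 k * Real.cos (kdot k x)) (cube (n + 1)) volume :=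
    hg0.mul_continuousOn hcont.continuousOn (isCompact_univ_pi fun _ => isCompact_Icc)
  rw [htrans hG0, htrans hga.abs]
  -- the bound holds fibrewise, almost everywhere in `k'`
  set Φ : (Fin n → ℝ) → ℝ := fun k' => ∫ t in Set.Icc (-π) π, |g a (j.insertNth t k')| with hΦ
  have hΦint : Integrable Φ μ₂ := by
    have h := (hintT hga).integral_norm_prod_right
    refine h.congr (ae_of_all _ fun k' => ?_)
    simp only [hΦ, Real.norm_eq_abs]
    rfl
  have hae0 : ∀ᵐ k' ∂μ₂, k' ≠ (0 : Fin n → ℝ) := by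
    rw [ae_iff]
    have hsub : {k' : Fin n → ℝ | ¬k' ≠ 0} ⊆ {0} := fun k hk => by simpa using hk
    exact le_antisymm ((((measure_mono hsub).trans (Measure.restrict_apply_le _ _))).trans
      (measure_singleton _).le) bot_le
  have hbound : ∀ᵐ k' ∂μ₂,
      ‖|((x j : ℤ) : ℝ)| ^ a * ∫ t in Set.Icc (-π) π,
          g 0 (j.insertNth t k') * Real.cos (kdot (j.insertNth t k' : Fin (n + 1) → ℝ) x)‖ ≤ Φ k' := by
    filter_upwards [hae0, (hintT hg0).prod_left_ae, (hintT hga).prod_left_ae,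
      self_mem_ae_restrict (measurableSet_brillouin n)] with k' hk0 hI0 hIa hk'
    -- the fibre family `u m t = g_m (t ↦ j, k')`
    set u : ℕ → ℝ → ℝ := fun m t => g m (j.insertNth t k') with hu
    set c : ℝ := ∑ l, k' l * (x (j.succAbove l) : ℝ) with hc
    have hmem : ∀ t ∈ Set.uIcc (-π) π, (j.insertNth t k' : Fin (n + 1) → ℝ) ∈ cube (n + 1) := by
      intro t ht
      rw [Set.uIcc_of_le hππ] at ht
      exact (insertNth_mem_cube_iff j t k').2 ⟨ht, hk'⟩
    have hoff : ∀ t, Function.update (j.insertNth t k' : Fin (n + 1) → ℝ) j 0 ≠ 0 := by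
      intro t h
      rw [Fin.update_insertNth] at h
      exact hk0 (eq_zero_of_insertNth_zero j h)
    have hder' : ∀ m < a, ∀ t ∈ Set.uIcc (-π) π, HasDerivAt (u m) (u (m + 1) t) t := by
      intro m hm t ht
      have h := hder m hm _ (hmem t ht) (hoff t)
      simp only [Fin.update_insertNth, Fin.insertNth_apply_same] at h
      exact h
    have hper' : ∀ m < a, u m (-π) = u m π := by
      intro m hm
      have h := hper m hm.le _ (hmem (-π) (by rw [Set.uIcc_of_le hππ]; exact ⟨le_rfl, hππ⟩))
      simp only [Fin.update_insertNth, Fin.insertNth_apply_same] at h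
      rw [show -π + 2 * π = π by ring] at h
      exact h.symm
    have h0' : IntervalIntegrable (u 0) volume (-π) π :=
      (intervalIntegrable_iff_integrableOn_Icc_of_le hππ).2 hI0
    have ha' : IntervalIntegrable (u a) volume (-π) π :=
      (intervalIntegrable_iff_integrableOn_Icc_of_le hππ).2 hIa
    have h1d := abs_pow_mul_intervalIntegral_cos_le a u (x j) c hder' hper' h0' ha'
    -- identify the inner integrals with interval integrals
    have hinner : ∫ t in Set.Icc (-π) π,
        g 0 (j.insertNth t k') * Real.cos (kdot (j.insertNth t k' : Fin (n + 1) → ℝ) x) =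
        ∫ t in (-π)..π, u 0 t * Real.cos (t * (x j : ℤ) + c) := by
      rw [intervalIntegral.integral_of_le hππ, integral_Icc_eq_integral_Ioc]
      refine setIntegral_congr_fun measurableSet_Ioc fun t _ => ?_
      rw [kdot_insertNth]
    have hΦk : Φ k' = ∫ t in (-π)..π, |u a t| := by
      simp only [hΦ, hu]
      rw [intervalIntegral.integral_of_le hππ, integral_Icc_eq_integral_Ioc]
    rw [hinner, hΦk, Real.norm_eq_abs, abs_mul, abs_pow, abs_abs]
    exact h1d
  -- integrate the fibrewise bound
  calc |((x j : ℤ) : ℝ)| ^ a * |∫ k' in cube n, ∫ t in Set.Icc (-π) π,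
          g 0 (j.insertNth t k') * Real.cos (kdot (j.insertNth t k' : Fin (n + 1) → ℝ) x)|
      = ‖∫ k' in cube n, |((x j : ℤ) : ℝ)| ^ a * ∫ t in Set.Icc (-π) π,
          g 0 (j.insertNth t k') * Real.cos (kdot (j.insertNth t k' : Fin (n + 1) → ℝ) x)‖ := by
        rw [_root_.MeasureTheory.integral_const_mul, Real.norm_eq_abs, abs_mul, abs_pow, abs_abs]
    _ ≤ ∫ k' in cube n, Φ k' := norm_integral_le_of_norm_le hΦint hbound

end Literature.Barriers.CriticalPhenomena.SpreadOutIsing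

end
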